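import Mathlib
import HarnessLib
import Literature.MathematicalPhysics.StatisticalMechanics.FluctuationKernelComparisonNearTorusFRD
import Literature.MathematicalPhysics.StatisticalMechanics.FluctuationKernelComparisonSecondLocalTorusFRD
import Literature.MathematicalPhysics.StatisticalMechanics.FluctuationKernelComparisonMidLocalTorusFRD
import Literature.MathematicalPhysics.StatisticalMechanics.TorusFRDStepKernelPair

/-!
# [ABKM19] Lemma 8.4 (`ℓ = 2`), volume-uniform, along a LINE of tuning parameters, for `k`-polymers NEAR a connected
# `(k+1)`-polymer `U`: `‖(R_{q+2y} − 2R_{q+y} + R_q)F‖_{k:k+1,X} ≤ b·ℓ_n(U)·|y|₁²·κ^{|X|_k}`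

Second-order companion of `FluctuationKernelComparisonNearTorusFRD`.  The kernel-only second-order twins of the four-kernel
comparison of `K_{k+1}` (block B4 of the line `banach_two_kernel` of the child `TwoKernelSkBound` of the cruxes `HypACumulant` /
`HypALocalTwoPoint`, route `Summits/HubbardSuperconductivity/…/Theses/ComplexGFFStiffness`; `RenormalisationMapKernelSecondDiffFamilies`)
take the second-order pair property of Lemma 8.4 on EVERY `k`-polymer `X ⊆ U + [−(2^d−1)L^k, (2^d−1)L^k]^d`.  The tree carries the
`ℓ = 2` property along LINES `q, q+y, q+2y`: the genuine second-order part along the linear kernel segment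
(`FluctuationKernelComparisonSecondLocalTorusFRD`, midpoint `½(𝒞_{1+q}+𝒞_{1+q+2y})`) and the first-order distance of that midpoint
from the true kernel `𝒞_{1+q+y}` (`FluctuationKernelComparisonMidLocalTorusFRD`); both are LOCAL (small torus of side `L^{N̄}` chosen
from the diameter of `X*⁺`).  As in the first-order near-`U` file, `X ⊆ U + [−r,r]^d` has `diam_∞(X*⁺) + 1 ≤ D₀L^k`,
`D₀ = L|U|_{k+1} + 2(2^{d+1}+R) + 2p_Φ + 1`, so `L^{(N̄−k−1)d} ≤ (2D₀)^d` and

* **`tayNormLE_fluct_lineSecondDiff_near_of_torusFRD`** —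
  `‖fluct 𝒞_{1+q+2y} F − fluct 𝒞_{1+q+y} F − fluct 𝒞_{1+q+y} F + fluct 𝒞_{1+q} F‖_{k:k+1,X}
   ≤ b·((r₀+1)·27q_H²·(S_U·(T e^{2KT}K))² + 2·(r₀+1)·8q_H·(S_U·(½|y|₁²K₂)))·κ^{|X|_k}`,
  `S_U = (3^{d+1}(2D₀)^d)^{1/2}`, `T = |2y|₁`, `K = K(c, C_ℓ(1))`, `K₂ = K(c, C_ℓ(2))` — `N`-free, `O(|y|₁²)`, polynomial in `|U|_{k+1}`.

Written in the four-corner shape `R_a − R_b − R_c + R_e` with `b = c` (the form consumed by the kernel second-difference tool).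
Everything is proved; no named fact.  Nothing about superconductivity in the Hubbard model.

## References
* S. Buchholz, J. Funct. Anal. 275 (2018), Thm 4.5 [Buchholz2016].
* S. Adams, S. Buchholz, R. Kotecký, S. Müller, arXiv:1910.13564, Lemma 8.4, Lemma 12.6 (12.53) [AdamsBuchholzKoteckyMuller2019].
-/


noncomputable section

namespace Literature.MathematicalPhysics.StatisticalMechanics.GradientRG

open scoped BigOperators
open Real Set Finset MeasureTheory
open Literature.MathematicalPhysics.StatisticalMechanics.GradientFRD
  (fourierCoeff cExt cExt_of_mem IsElliptic IsUnitSymm InShell iterDiff supNorm conv ellOp isElliptic_one)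
open Literature.MathematicalPhysics.StatisticalMechanics.TorusPolymer
  (IsPolymer numBlocks thicken blocks mem_thicken card_blocks_eq_numBlocks supNorm_sub_le supNorm_sub_comm
    supNorm_sub_lt_of_isConn)
open Literature.Barriers.CriticalPhenomena.LongRangePhi4.Polymer (IsConn)
open Literature.MathematicalPhysics.QuantumFieldTheory

variable {d M : ℕ} [NeZero M]

section Package

variable {L N Mord R n ñ : ℕ} {θbar lam μ δ₁ δ₀ A𝒫 : ℝ}
    {𝒞 : Matrix (Fin d) (Fin d) ℝ → ℕ → (Fin d → ZMod M) → ℝ} {Mc : ℕ → ℝ}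
    {Cα : (Fin d → ℕ) → ℕ → ℝ} {c C : ℝ} {Cℓ : ℕ → ℝ}

set_option maxHeartbeats 3200000 in
/-- **[ABKM19] Lemma 8.4 (`ℓ = 2`) along a line, volume-uniform form for a `k`-polymer NEAR a connected `(k+1)`-polymer**
(module docstring): under the package hypotheses of `tayNormLE_fluct_secondDiff_local_of_torusFRD` /
`tayNormLE_fluct_mid_sub_fluct_local_of_torusFRD` (`C_ℓ(2) ≥ 0`), `k + 1 ≤ N`, three points `q, q+y, q+2y` of the tuning ball
(symmetric, entry sums `≤ T₀`), `U` connected, `X ⊆ U + [−(2^d−1)L^k, (2^d−1)L^k]^d` a `k`-polymer, `F` a `T_k^{X*}`-local `C^{r₀}`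
functional with `‖F‖_{k,X} ≤ b`. [cite: AdamsBuchholzKoteckyMuller2019, Lemma 8.4 / Lemma 12.6 (12.53)] -/
theorem tayNormLE_fluct_lineSecondDiff_near_of_torusFRD
    (hd : 3 ≤ d) (hMord : 1 ≤ Mord) (hMR : Mord ≤ R) (hLodd : Odd L) (hL : 2 ^ (d + 3) + 16 * R ≤ L)
    (hM : M = L ^ N)
    (hθbar : 0 < θbar) (hlam : 0 < lam) (hn : 2 * Mord ≤ n) (hn2 : 2 ≤ n) (hnñ : n ≤ ñ)
    (hgap : d + 1 ≤ 2 * (ñ - n))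
    (hc : 0 < c) (hC1 : 0 ≤ Cℓ 1) (hC2 : 0 ≤ Cℓ 2)
    (hallA : ∀ A : Matrix (Fin d) (Fin d) ℝ, IsElliptic (1 / 2 : ℝ) 2 A →
        (∀ k, 1 ≤ k → k ≤ N + 1 →
          ∑ x : Fin d → ZMod M, 𝒞 A k x = 0 ∧ ∀ x, 𝒞 A k (-x) = 𝒞 A k x) ∧
        (∀ k, 1 ≤ k → k ≤ N + 1 → ∀ φ : (Fin d → ZMod M) → ℝ, ∑ x, φ x = 0 →
          0 ≤ ∑ x, ∑ y, φ x * 𝒞 A k (x - y) * φ y) ∧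
        (∀ φ : (Fin d → ZMod M) → ℝ, ∑ x, φ x = 0 →
          ellOp A (conv (fun x => ∑ k ∈ Finset.Icc 1 (N + 1), 𝒞 A k x) φ) = φ) ∧
        (∀ k, 1 ≤ k → k ≤ N → Mc k ≤ 0 ∧
          ∀ x : Fin d → ZMod M, ((L : ℝ) ^ k) / 2 ≤ (supNorm x : ℝ) →
            𝒞 A k x = Mc k) ∧
        (∀ k, 1 ≤ k → k ≤ N + 1 → ∀ B : Matrix (Fin d) (Fin d) ℝ, IsUnitSymm B →
          (∃ ε : ℝ, 0 < ε ∧ ∀ x : Fin d → ZMod M,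
            ContDiffOn ℝ ⊤ (fun s : ℝ => 𝒞 (A + s • B) k x) (Set.Ioo (-ε) ε)) ∧
          ∀ α : Fin d → ℕ, ∑ i, α i ≤ n → ∀ ℓ : ℕ, ∀ x : Fin d → ZMod M,
            abs (iteratedDeriv ℓ (fun s : ℝ => iterDiff α (𝒞 (A + s • B) k) x) 0)
              ≤ Cα α ℓ / (L : ℝ) ^ ((k - 1) * (d - 2 + ∑ i, α i))) ∧
        (∀ k, 1 ≤ k → k ≤ N + 1 → ∀ j : ℕ, ∀ κ : Fin d → ZMod M, κ ≠ 0 → InShell L j κ →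
          (j < k →
            c / (L : ℝ) ^ (2 * (d + ñ) + 1) * (L : ℝ) ^ (2 * j)
                / (L : ℝ) ^ ((k - j) * (d - 1 + n)) ≤ (fourierCoeff (𝒞 A k) κ).re ∧
            ‖fourierCoeff (𝒞 A k) κ‖
              ≤ C * (L : ℝ) ^ (2 * (d + ñ) + 1) * (L : ℝ) ^ (2 * j)
                  / (L : ℝ) ^ ((k - j) * (d - 1 + n))) ∧
          (k ≤ j →
            c / (L : ℝ) ^ (2 * (d + ñ) + 1) * (L : ℝ) ^ (2 * k)
                ≤ (fourierCoeff (𝒞 A k) κ).re ∧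
            ‖fourierCoeff (𝒞 A k) κ‖ ≤ C * (L : ℝ) ^ (2 * k)) ∧
          ∀ B : Matrix (Fin d) (Fin d) ℝ, IsUnitSymm B → ∀ ℓ : ℕ, 1 ≤ ℓ →
            (j < k →
              ‖iteratedDeriv ℓ (fun s : ℝ => fourierCoeff (𝒞 (A + s • B) k) κ) 0‖
                ≤ Cℓ ℓ * (L : ℝ) ^ (2 * (d + ñ) + 1) * (L : ℝ) ^ (2 * j)
                    / (L : ℝ) ^ ((k - j) * (d - 1 + ñ))) ∧
            (k ≤ j →
              ‖iteratedDeriv ℓ (fun s : ℝ => fourierCoeff (𝒞 (A + s • B) k) κ) 0‖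
                ≤ Cℓ ℓ * (L : ℝ) ^ (2 * k))))
    (hB : AbkmWeightBounds L N Mord R n θbar lam μ δ₁ δ₀ A𝒫 (fun j => 𝒞 1 j)
      (abkmWeightData L N Mord R θbar (schedDelta δ₀ δ₁ N) fun j => 𝒞 1 j))
    {k : ℕ} (hkN : k + 1 ≤ N) {ρ : ℝ} (hρ0 : 0 ≤ ρ) (hρ : ρ < θbar)
    {T₀ : ℝ} (hT₀ : T₀ ≤ 1 / 2) (hKT₀ : shellRatioConst c (Cℓ 1) (L : ℝ) d ñ * T₀ ≤ Real.log (1 + ρ))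
    {q y : Matrix (Fin d) (Fin d) ℝ} (hq : q.IsSymm) (hy : y.IsSymm)
    (hqT : ∑ i, ∑ j, |q i j| ≤ T₀) (hqyT : ∑ i, ∑ j, |(q + y) i j| ≤ T₀)
    (hq2yT : ∑ i, ∑ j, |(q + (2 : ℝ) • y) i j| ≤ T₀)
    {p qH ρ'' : ℝ} (hpq : p.HolderConjugate qH) (hρ''0 : 0 ≤ ρ'') (hρ'' : ρ'' < θbar)
    (hpρ : p * (1 + ρ) ≤ 1 + ρ'')
    {pT r₀ : ℕ} {h A : ℝ} {U : Finset (Fin d → ZMod M)} (hUc : IsConn U)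
    {X : Finset (Fin d → ZMod M)} (hX : IsPolymer (L ^ k) X) (hXU : X ⊆ thicken ((2 ^ d - 1) * L ^ k) U)
    {F : ((Fin d → ZMod M) → ℝ) → ℂ} {b : ℝ} (hb : 0 ≤ b) (hFd : ContDiff ℝ r₀ F)
    (hFloc : IsGaugeLocal ((abkmNormParams L N Mord R pT r₀ h θbar A (schedDelta δ₀ δ₁ N)
      fun j => 𝒞 1 j).gauge k X) F)
    (hF : TayNormLE ((abkmNormParams L N Mord R pT r₀ h θbar A (schedDelta δ₀ δ₁ N) fun j => 𝒞 1 j).gauge k X)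
      r₀ ((abkmWeightData L N Mord R θbar (schedDelta δ₀ δ₁ N) fun j => 𝒞 1 j).weight k X) F b) :
    TayNormLE ((abkmNormParams L N Mord R pT r₀ h θbar A (schedDelta δ₀ δ₁ N) fun j => 𝒞 1 j).gauge k X) r₀
      ((abkmWeightData L N Mord R θbar (schedDelta δ₀ δ₁ N) fun j => 𝒞 1 j).midWeight k X)
      (fluct (𝒞 ((1 : Matrix (Fin d) (Fin d) ℝ) + (q + (2 : ℝ) • y)) (k + 1)) F -
        fluct (𝒞 ((1 : Matrix (Fin d) (Fin d) ℝ) + (q + y)) (k + 1)) F -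
        fluct (𝒞 ((1 : Matrix (Fin d) (Fin d) ℝ) + (q + y)) (k + 1)) F +
        fluct (𝒞 ((1 : Matrix (Fin d) (Fin d) ℝ) + q) (k + 1)) F)
      (b * ((r₀ + 1) * (27 * qH ^ 2 *
            (Real.sqrt ((3 : ℝ) ^ (d + 1) * ((2 * (L * numBlocks (L ^ (k + 1)) U + 2 * (2 ^ (d + 1) + R) + 2 * pT + 1) : ℕ) : ℝ) ^ d) *
              ((∑ i, ∑ j, |((q + (2 : ℝ) • y) - q) i j|) *
                Real.exp (2 * shellRatioConst c (Cℓ 1) (L : ℝ) d ñ * (∑ i, ∑ j, |((q + (2 : ℝ) • y) - q) i j|)) *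
                shellRatioConst c (Cℓ 1) (L : ℝ) d ñ)) ^ 2) +
          2 * ((r₀ + 1) * (8 * qH *
            (Real.sqrt ((3 : ℝ) ^ (d + 1) * ((2 * (L * numBlocks (L ^ (k + 1)) U + 2 * (2 ^ (d + 1) + R) + 2 * pT + 1) : ℕ) : ℝ) ^ d) *
              (2⁻¹ * (∑ i, ∑ j, |y i j|) ^ 2 * shellRatioConst c (Cℓ 2) (L : ℝ) d ñ))))) *
        (weightIntConstRho θbar ρ'' (traceConst d Mord R lam (derivSum d n fun θ' _ => Cα θ' 0)) ^ (1 / p)) ^ numBlocks (L ^ k) X) := by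
  have h8 : 8 ≤ 2 ^ (d + 3) := by
    calc 8 = 2 ^ 3 := by norm_num
      _ ≤ 2 ^ (d + 3) := Nat.pow_le_pow_right (by norm_num) (by omega)
  have hL2 : 2 ≤ L := by omega
  have hL1 : 1 ≤ L := by omega
  have hL1r : (1 : ℝ) ≤ (L : ℝ) := by exact_mod_cast hL1
  -- the number of blocks of `U` and the diameter scale `D₀`
  set m := numBlocks (L ^ (k + 1)) U with hmdef
  set D₀ : ℕ := L * m + 2 * (2 ^ (d + 1) + R) + 2 * pT + 1 with hD₀
  have hD₀pos : 1 ≤ D₀ := by omega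
  -- the auxiliary scale: `t = log_L (2 D₀) + 1`, `N̄ = min N (k + t)`
  set t : ℕ := Nat.log L (2 * D₀) + 1 with htdef
  have ht1 : 1 ≤ t := by omega
  have hLt : 2 * D₀ < L ^ t := by rw [htdef]; exact Nat.lt_pow_succ_log_self (by omega) _
  have hLt' : L ^ (t - 1) ≤ 2 * D₀ := by
    rw [htdef, Nat.add_sub_cancel]
    exact Nat.pow_log_le_self L (by omega)
  set Nb : ℕ := min N (k + t) with hNbdef
  have hNbk : k + 1 ≤ Nb := le_min hkN (by omega)
  have hNbN : Nb ≤ N := min_le_left _ _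
  -- the diameter of `X*⁺`: `X ⊆ U + [−r,r]^d`, `U` connected at scale `k+1`
  have hdiamU : ∀ x ∈ U, ∀ y ∈ U, supNorm (x - y) + 1 ≤ m * L ^ (k + 1) := by
    intro x hx y hy
    have := supNorm_sub_lt_of_isConn (s := L ^ (k + 1)) hLodd.pow hUc le_rfl hx hy
    rwa [card_blocks_eq_numBlocks] at this
  have hdiamX : ∀ x ∈ X, ∀ y ∈ X, supNorm (x - y) + 1 ≤ m * L ^ (k + 1) + 2 * ((2 ^ d - 1) * L ^ k) := by
    intro x hx y hy
    obtain ⟨u₁, hu₁, hxu₁⟩ := mem_thicken.1 (hXU hx)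
    obtain ⟨u₂, hu₂, hyu₂⟩ := mem_thicken.1 (hXU hy)
    have h1 := hdiamU u₁ hu₁ u₂ hu₂
    have h2 := supNorm_sub_le x u₁ y
    have h3 := supNorm_sub_le u₁ u₂ y
    have h4 : supNorm (u₂ - y) = supNorm (y - u₂) := supNorm_sub_comm u₂ y
    omega
  have hrad : starRad R L d k ≤ (2 ^ d + R) * L ^ k := starRad_le hL1 d k
  have hpT : pT ≤ pT * L ^ k := Nat.le_mul_of_pos_right _ (Nat.one_le_pow _ _ (by omega))
  have h2d1 : 1 ≤ 2 ^ d := Nat.one_le_two_pow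
  have hdiam' : ∀ x' ∈ thicken pT (thicken (starRad R L d k) X), ∀ y' ∈ thicken pT (thicken (starRad R L d k) X),
      supNorm (x' - y') + 1 ≤ D₀ * L ^ k := by
    intro x' hx' y' hy'
    obtain ⟨x, hx, y, hy, hle⟩ := supNorm_sub_le_of_mem_thicken_thicken hx' hy'
    have h1 := hdiamX x hx y hy
    have h2 : D₀ * L ^ k = m * L ^ (k + 1) + 2 * ((2 ^ d - 1) * L ^ k) + 2 * ((2 ^ d + R) * L ^ k) + 2 * L ^ k +
        2 * (pT * L ^ k) + L ^ k := by
      have e1 : 2 ^ (d + 1) = 2 * 2 ^ d := by rw [pow_succ]; ring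
      rw [hD₀, e1, pow_succ]
      zify [h2d1]
      ring
    have h3 : 1 ≤ L ^ k := Nat.one_le_pow _ _ (by omega)
    omega
  have hdiam : ∀ x' ∈ thicken pT (thicken (starRad R L d k) X), ∀ y' ∈ thicken pT (thicken (starRad R L d k) X),
      supNorm (x' - y') ≤ L ^ Nb / 2 := by
    intro x' hx' y' hy'
    rcases le_or_gt N (k + t) with hN | hN
    · -- `N̄ = N`: everything is within `M/2`
      have hNb : Nb = N := min_eq_left hN
      rw [hNb, ← hM]
      exact supNorm_le_half _
    · have hNb : Nb = k + t := min_eq_right hN.le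
      rw [hNb]
      have h1 := hdiam' x' hx' y' hy'
      have h2 : 2 * (D₀ * L ^ k) ≤ L ^ (k + t) := by
        have h3 : 2 * D₀ * L ^ k ≤ L ^ t * L ^ k := Nat.mul_le_mul_right _ hLt.le
        calc 2 * (D₀ * L ^ k) = 2 * D₀ * L ^ k := by ring
          _ ≤ L ^ t * L ^ k := h3
          _ = L ^ (k + t) := by rw [← pow_add, Nat.add_comm t k]
      omega
  -- symmetric third point
  have hq2 : (q + (2 : ℝ) • y).IsSymm := hq.add (hy.smul _)
  -- the two local estimates at the auxiliary scale
  have hsec := tayNormLE_fluct_secondDiff_local_of_torusFRD hd hMord hMR hLodd hL hM hθbar hlam hn hn2 hnñ hgap hc hC1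
    hallA hB hρ0 hρ hT₀ hKT₀ hq hq2 hqT hq2yT hpq hρ''0 hρ'' hpρ hX hNbk hNbN hdiam hb hFd hFloc hF
    (pT := pT) (r₀ := r₀) (h := h) (A := A)
  have hmid := tayNormLE_fluct_mid_sub_fluct_local_of_torusFRD hd hMord hMR hLodd hL hM hθbar hlam hn hn2 hnñ hgap hc hC1 hC2
    hallA hB hρ0 hρ hT₀ hKT₀ hq hy hqT hqyT hq2yT hpq hρ''0 hρ'' hpρ hX hNbk hNbN hdiam hb hFd hFloc hF
    (pT := pT) (r₀ := r₀) (h := h) (A := A)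
  -- smoothness of the three fluctuation integrals (corner kernels and the convex midpoint kernel)
  have hk : k + 1 ≤ N + 1 := by omega
  have hS2 := stepKernelBounds_one_add_of_torusFRD hd hMord hMR hLodd hL hθbar hlam hn hn2 hnñ hc hC1 hallA hB hk
    hρ0 hρ hT₀ hKT₀ hq2 hq2yT
  have hS1 := stepKernelBounds_one_add_of_torusFRD hd hMord hMR hLodd hL hθbar hlam hn hn2 hnñ hc hC1 hallA hB hk
    hρ0 hρ hT₀ hKT₀ (hq.add hy) hqyT
  have hS0 := stepKernelBounds_one_add_of_torusFRD hd hMord hMR hLodd hL hθbar hlam hn hn2 hnñ hc hC1 hallA hB hk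
    hρ0 hρ hT₀ hKT₀ hq hqT
  have h1ρ : (1 : ℝ) * (1 + ρ) ≤ 1 + ρ := by rw [one_mul]
  have hSm : StepKernelBounds (abkmWeightData L N Mord R θbar (schedDelta δ₀ δ₁ N) fun j => 𝒞 1 j) L k
      (weightIntConstRho θbar ρ (traceConst d Mord R lam (derivSum d n fun θ' _ => Cα θ' 0)))
      (1 * secondDiffConst fun θ' => Cα θ' 0)
      (fun x => 2⁻¹ * 𝒞 ((1 : Matrix (Fin d) (Fin d) ℝ) + q) (k + 1) x +
        2⁻¹ * 𝒞 ((1 : Matrix (Fin d) (Fin d) ℝ) + (q + (2 : ℝ) • y)) (k + 1) x) := by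
    have h1 := stepKernelBounds_const_mul_convex3_of_torusFRD hd hMord hMR hLodd hL hθbar hlam hn hn2 hnñ hc hC1
      hallA hB hk hρ0 hT₀ hKT₀ hq hq hq2 hqT hqT hq2yT (p := 1) zero_le_one hρ0 hρ h1ρ
      (a := 2⁻¹) (b := 0) (c₃ := 2⁻¹) (by norm_num) le_rfl (by norm_num) (by norm_num)
    have e : (fun x => (1 : ℝ) * (2⁻¹ * 𝒞 ((1 : Matrix (Fin d) (Fin d) ℝ) + q) (k + 1) x +
        0 * 𝒞 ((1 : Matrix (Fin d) (Fin d) ℝ) + q) (k + 1) x +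
        2⁻¹ * 𝒞 ((1 : Matrix (Fin d) (Fin d) ℝ) + (q + (2 : ℝ) • y)) (k + 1) x)) =
        fun x => 2⁻¹ * 𝒞 ((1 : Matrix (Fin d) (Fin d) ℝ) + q) (k + 1) x +
          2⁻¹ * 𝒞 ((1 : Matrix (Fin d) (Fin d) ℝ) + (q + (2 : ℝ) • y)) (k + 1) x := by
      funext x; ring
    rw [e] at h1
    exact h1
  set P := abkmNormParams L N Mord R pT r₀ h θbar A (schedDelta δ₀ δ₁ N) fun j => 𝒞 1 j with hP
  have hcd2 := hS2.contDiff_fluct hB.dominated X (P.gauge k X) hb hFd hFloc hF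
  have hcd1 := hS1.contDiff_fluct hB.dominated X (P.gauge k X) hb hFd hFloc hF
  have hcd0 := hS0.contDiff_fluct hB.dominated X (P.gauge k X) hb hFd hFloc hF
  have hcdm := hSm.contDiff_fluct hB.dominated X (P.gauge k X) hb hFd hFloc hF
  -- combine: `R₂ − R₁ − R₁ + R₀ = (R₂ − 2R_m + R₀) + 2(R_m − R₁)`
  have hsecd : ContDiff ℝ r₀ (fluct (𝒞 ((1 : Matrix (Fin d) (Fin d) ℝ) + (q + (2 : ℝ) • y)) (k + 1)) F -
        (2 : ℝ) • fluct (fun x => 2⁻¹ * 𝒞 ((1 : Matrix (Fin d) (Fin d) ℝ) + q) (k + 1) x +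
          2⁻¹ * 𝒞 ((1 : Matrix (Fin d) (Fin d) ℝ) + (q + (2 : ℝ) • y)) (k + 1) x) F +
        fluct (𝒞 ((1 : Matrix (Fin d) (Fin d) ℝ) + q) (k + 1)) F) :=
    (hcd2.sub (hcdm.const_smul (2 : ℝ))).add hcd0
  have hmidd : ContDiff ℝ r₀ (fluct (fun x => 2⁻¹ * 𝒞 ((1 : Matrix (Fin d) (Fin d) ℝ) + q) (k + 1) x +
          2⁻¹ * 𝒞 ((1 : Matrix (Fin d) (Fin d) ℝ) + (q + (2 : ℝ) • y)) (k + 1) x) F -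
        fluct (𝒞 ((1 : Matrix (Fin d) (Fin d) ℝ) + (q + y)) (k + 1)) F) := hcdm.sub hcd1
  have hcomb := hsec.add (hmid.smul hmidd 2) hsecd (hmidd.const_smul (2 : ℝ))
  have hfun : (fluct (𝒞 ((1 : Matrix (Fin d) (Fin d) ℝ) + (q + (2 : ℝ) • y)) (k + 1)) F -
        (2 : ℝ) • fluct (fun x => 2⁻¹ * 𝒞 ((1 : Matrix (Fin d) (Fin d) ℝ) + q) (k + 1) x +
          2⁻¹ * 𝒞 ((1 : Matrix (Fin d) (Fin d) ℝ) + (q + (2 : ℝ) • y)) (k + 1) x) F +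
        fluct (𝒞 ((1 : Matrix (Fin d) (Fin d) ℝ) + q) (k + 1)) F) +
      (2 : ℝ) • (fluct (fun x => 2⁻¹ * 𝒞 ((1 : Matrix (Fin d) (Fin d) ℝ) + q) (k + 1) x +
          2⁻¹ * 𝒞 ((1 : Matrix (Fin d) (Fin d) ℝ) + (q + (2 : ℝ) • y)) (k + 1) x) F -
        fluct (𝒞 ((1 : Matrix (Fin d) (Fin d) ℝ) + (q + y)) (k + 1)) F) =
      fluct (𝒞 ((1 : Matrix (Fin d) (Fin d) ℝ) + (q + (2 : ℝ) • y)) (k + 1)) F -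
        fluct (𝒞 ((1 : Matrix (Fin d) (Fin d) ℝ) + (q + y)) (k + 1)) F -
        fluct (𝒞 ((1 : Matrix (Fin d) (Fin d) ℝ) + (q + y)) (k + 1)) F +
        fluct (𝒞 ((1 : Matrix (Fin d) (Fin d) ℝ) + q) (k + 1)) F := by
    funext φ
    simp only [Pi.add_apply, Pi.sub_apply, Pi.smul_apply, Complex.real_smul]
    push_cast
    ring
  rw [hfun] at hcomb
  -- the diameter factor `L^{(N̄ − (k+1))d} ≤ (2 D₀)^d` and monotonicity of the constant
  have hexp : (L : ℝ) ^ ((Nb - (k + 1)) * d) ≤ ((2 * D₀ : ℕ) : ℝ) ^ d := by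
    have h1 : Nb - (k + 1) ≤ t - 1 := by omega
    have h2 : L ^ (Nb - (k + 1)) ≤ 2 * D₀ := (Nat.pow_le_pow_right hL1 h1).trans hLt'
    have h3 : (L : ℝ) ^ (Nb - (k + 1)) ≤ ((2 * D₀ : ℕ) : ℝ) := by exact_mod_cast h2
    rw [pow_mul]
    exact pow_le_pow_left₀ (by positivity) h3 d
  have hsqrt : Real.sqrt ((3 : ℝ) ^ (d + 1) * (L : ℝ) ^ ((Nb - (k + 1)) * d)) ≤
      Real.sqrt ((3 : ℝ) ^ (d + 1) * ((2 * D₀ : ℕ) : ℝ) ^ d) :=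
    Real.sqrt_le_sqrt (mul_le_mul_of_nonneg_left hexp (by positivity))
  have hD₀cast : ((2 * D₀ : ℕ) : ℝ) = ((2 * (L * numBlocks (L ^ (k + 1)) U + 2 * (2 ^ (d + 1) + R) + 2 * pT + 1) : ℕ) : ℝ) := by
    rw [hD₀]
  rw [hD₀cast] at hsqrt
  have hK10 : 0 ≤ shellRatioConst c (Cℓ 1) (L : ℝ) d ñ := shellRatioConst_nonneg hc hC1 (Nat.cast_nonneg _) d ñ
  have hK20 : 0 ≤ shellRatioConst c (Cℓ 2) (L : ℝ) d ñ := shellRatioConst_nonneg hc hC2 (Nat.cast_nonneg _) d ñ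
  have hT0 : 0 ≤ (∑ i, ∑ j, |((q + (2 : ℝ) • y) - q) i j|) := sum_nonneg fun _ _ => sum_nonneg fun _ _ => abs_nonneg _
  have hY0 : 0 ≤ ∑ i, ∑ j, |y i j| := sum_nonneg fun _ _ => sum_nonneg fun _ _ => abs_nonneg _
  have hA𝒫p : 0 ≤ weightIntConstRho θbar ρ'' (traceConst d Mord R lam (derivSum d n fun θ' _ => Cα θ' 0)) :=
    zero_le_one.trans (one_le_weightIntConstRho hθbar hρ''0 hρ''
      (traceConst_nonneg d Mord R hlam.le (derivSum_nonneg d n _)))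
  have hqH0 : 0 ≤ qH := le_of_lt (lt_trans one_pos hpq.symm.lt)
  have hsq0 : 0 ≤ Real.sqrt ((3 : ℝ) ^ (d + 1) * (L : ℝ) ^ ((Nb - (k + 1)) * d)) := Real.sqrt_nonneg _
  refine hcomb.mono ?_ (fun φ => ((abkmWeightData L N Mord R θbar (schedDelta δ₀ δ₁ N) fun j => 𝒞 1 j).midWeight_pos k X φ).le)
  have hwpos : 0 ≤ (weightIntConstRho θbar ρ'' (traceConst d Mord R lam (derivSum d n fun θ' _ => Cα θ' 0)) ^ (1 / p)) ^ numBlocks (L ^ k) X := pow_nonneg (Real.rpow_nonneg hA𝒫p _) _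
  rw [abs_of_nonneg (by norm_num : (0 : ℝ) ≤ 2)]
  -- both summands are monotone in the diameter factor
  have hE0 : 0 ≤ (∑ i, ∑ j, |((q + (2 : ℝ) • y) - q) i j|) * Real.exp (2 * shellRatioConst c (Cℓ 1) (L : ℝ) d ñ * (∑ i, ∑ j, |((q + (2 : ℝ) • y) - q) i j|)) * shellRatioConst c (Cℓ 1) (L : ℝ) d ñ := by positivity
  have h1 : (r₀ + 1) * (27 * qH ^ 2 * (Real.sqrt ((3 : ℝ) ^ (d + 1) * (L : ℝ) ^ ((Nb - (k + 1)) * d)) *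
        ((∑ i, ∑ j, |((q + (2 : ℝ) • y) - q) i j|) * Real.exp (2 * shellRatioConst c (Cℓ 1) (L : ℝ) d ñ * (∑ i, ∑ j, |((q + (2 : ℝ) • y) - q) i j|)) * shellRatioConst c (Cℓ 1) (L : ℝ) d ñ)) ^ 2) ≤
      (r₀ + 1) * (27 * qH ^ 2 * (Real.sqrt ((3 : ℝ) ^ (d + 1) * ((2 * (L * numBlocks (L ^ (k + 1)) U + 2 * (2 ^ (d + 1) + R) + 2 * pT + 1) : ℕ) : ℝ) ^ d) *
        ((∑ i, ∑ j, |((q + (2 : ℝ) • y) - q) i j|) * Real.exp (2 * shellRatioConst c (Cℓ 1) (L : ℝ) d ñ * (∑ i, ∑ j, |((q + (2 : ℝ) • y) - q) i j|)) * shellRatioConst c (Cℓ 1) (L : ℝ) d ñ)) ^ 2) := by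
    have hr0 : (0 : ℝ) ≤ (r₀ : ℝ) + 1 := by positivity
    refine mul_le_mul_of_nonneg_left (mul_le_mul_of_nonneg_left ?_ (by positivity)) hr0
    exact pow_le_pow_left₀ (mul_nonneg hsq0 hE0) (mul_le_mul_of_nonneg_right hsqrt hE0) 2
  have h2 : (r₀ + 1) * (8 * qH * (Real.sqrt ((3 : ℝ) ^ (d + 1) * (L : ℝ) ^ ((Nb - (k + 1)) * d)) *
        (2⁻¹ * (∑ i, ∑ j, |y i j|) ^ 2 * shellRatioConst c (Cℓ 2) (L : ℝ) d ñ))) ≤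
      (r₀ + 1) * (8 * qH * (Real.sqrt ((3 : ℝ) ^ (d + 1) * ((2 * (L * numBlocks (L ^ (k + 1)) U + 2 * (2 ^ (d + 1) + R) + 2 * pT + 1) : ℕ) : ℝ) ^ d) * (2⁻¹ * (∑ i, ∑ j, |y i j|) ^ 2 * shellRatioConst c (Cℓ 2) (L : ℝ) d ñ))) := by
    have hr0 : (0 : ℝ) ≤ (r₀ : ℝ) + 1 := by positivity
    refine mul_le_mul_of_nonneg_left (mul_le_mul_of_nonneg_left ?_ (by positivity)) hr0
    exact mul_le_mul_of_nonneg_right hsqrt (by positivity)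
  have hsum := add_le_add (mul_le_mul_of_nonneg_left h1 hb) (mul_le_mul_of_nonneg_left (mul_le_mul_of_nonneg_left h2 hb) (by norm_num : (0:ℝ) ≤ 2))
  calc b * ((r₀ + 1) * (27 * qH ^ 2 * (Real.sqrt ((3 : ℝ) ^ (d + 1) * (L : ℝ) ^ ((Nb - (k + 1)) * d)) *
            ((∑ i, ∑ j, |((q + (2 : ℝ) • y) - q) i j|) * Real.exp (2 * shellRatioConst c (Cℓ 1) (L : ℝ) d ñ * (∑ i, ∑ j, |((q + (2 : ℝ) • y) - q) i j|)) * shellRatioConst c (Cℓ 1) (L : ℝ) d ñ)) ^ 2)) *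
          (weightIntConstRho θbar ρ'' (traceConst d Mord R lam (derivSum d n fun θ' _ => Cα θ' 0)) ^ (1 / p)) ^ numBlocks (L ^ k) X +
        2 * (b * ((r₀ + 1) * (8 * qH * (Real.sqrt ((3 : ℝ) ^ (d + 1) * (L : ℝ) ^ ((Nb - (k + 1)) * d)) *
            (2⁻¹ * (∑ i, ∑ j, |y i j|) ^ 2 * shellRatioConst c (Cℓ 2) (L : ℝ) d ñ)))) *
          (weightIntConstRho θbar ρ'' (traceConst d Mord R lam (derivSum d n fun θ' _ => Cα θ' 0)) ^ (1 / p)) ^ numBlocks (L ^ k) X)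
      = (b * ((r₀ + 1) * (27 * qH ^ 2 * (Real.sqrt ((3 : ℝ) ^ (d + 1) * (L : ℝ) ^ ((Nb - (k + 1)) * d)) *
            ((∑ i, ∑ j, |((q + (2 : ℝ) • y) - q) i j|) * Real.exp (2 * shellRatioConst c (Cℓ 1) (L : ℝ) d ñ * (∑ i, ∑ j, |((q + (2 : ℝ) • y) - q) i j|)) * shellRatioConst c (Cℓ 1) (L : ℝ) d ñ)) ^ 2)) +
          2 * (b * ((r₀ + 1) * (8 * qH * (Real.sqrt ((3 : ℝ) ^ (d + 1) * (L : ℝ) ^ ((Nb - (k + 1)) * d)) *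
            (2⁻¹ * (∑ i, ∑ j, |y i j|) ^ 2 * shellRatioConst c (Cℓ 2) (L : ℝ) d ñ)))))) * (weightIntConstRho θbar ρ'' (traceConst d Mord R lam (derivSum d n fun θ' _ => Cα θ' 0)) ^ (1 / p)) ^ numBlocks (L ^ k) X := by ring
    _ ≤ (b * ((r₀ + 1) * (27 * qH ^ 2 * (Real.sqrt ((3 : ℝ) ^ (d + 1) * ((2 * (L * numBlocks (L ^ (k + 1)) U + 2 * (2 ^ (d + 1) + R) + 2 * pT + 1) : ℕ) : ℝ) ^ d) *
            ((∑ i, ∑ j, |((q + (2 : ℝ) • y) - q) i j|) * Real.exp (2 * shellRatioConst c (Cℓ 1) (L : ℝ) d ñ * (∑ i, ∑ j, |((q + (2 : ℝ) • y) - q) i j|)) * shellRatioConst c (Cℓ 1) (L : ℝ) d ñ)) ^ 2)) +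
          2 * (b * ((r₀ + 1) * (8 * qH * (Real.sqrt ((3 : ℝ) ^ (d + 1) * ((2 * (L * numBlocks (L ^ (k + 1)) U + 2 * (2 ^ (d + 1) + R) + 2 * pT + 1) : ℕ) : ℝ) ^ d) * (2⁻¹ * (∑ i, ∑ j, |y i j|) ^ 2 * shellRatioConst c (Cℓ 2) (L : ℝ) d ñ)))))) *
          (weightIntConstRho θbar ρ'' (traceConst d Mord R lam (derivSum d n fun θ' _ => Cα θ' 0)) ^ (1 / p)) ^ numBlocks (L ^ k) X := mul_le_mul_of_nonneg_right hsum hwpos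
    _ = _ := by ring

end Package

end Literature.MathematicalPhysics.StatisticalMechanics.GradientRG

end
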